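import Literature.AnabelianGeometry.EtaleTheta.Discharge.Sec5OfThetaSettingConstantsDictionary
import Literature.AnabelianGeometry.EtaleTheta.Discharge.Sec5DictionaryAtThetaSetting

/-!
# [EtTh] §5 AT THE SETTING, from ONE dictionary binder (sequel): Lemma 5.9 (iv) in full (`EnvIsoBiTheta`), the [IUTchII] Prop. 1.2 (ii) binder `hM` modulo the Prop. 5.2 (iii) ORIGIN CLAUSE, and Theorem 5.10 (iii) (pp. 332–335 / PDF pp. 106–109)

Mochizuki, *The étale theta function and its Frobenioid-theoretic manifestations*, Publ. RIMS **45** (2009)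
[cite: MochizukiEtTh2009, Lem 5.9 (iv) p.332 (PDF p.106)]; Prop. 5.2 (iii) p.324 (PDF p.98); Thm. 5.10 (iii) p.334 (PDF p.108).
Layer L2 of the abc-iut cell, seat abc-iut-L2-t11 (gen 4); MERGE-PLAN rows 9/11 AT THE JUNCTION (self-named 2026-08-26T11:15Z).  PROOF-ONLY
(0 defs), ADDITIVE sequel of abc-iut-L2-t4's `Discharge/Sec5OfThetaSettingConstantsDictionary.lean` (p440765: `hY`, `hYdd`, `hopenX` (from
temperedness), `hK`, `Facts`, and Lemma 5.9 (iv) "In particular" = `frdIsMonoThetaEnv_ofThetaSettingData_of_constantsDictionary` at the §5 data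
OF THE SETTING from this seat's ONE binder `ConstantsDictionary` (p439403/p439828)) and of abc-iut-f-125's `Sec5DictionaryAtThetaSetting.lean`
(p437488: the SOLVED FORM of F-0521 at the junction).  What this file adds, at `𝔉 := ofThetaSettingData μ hC hS h Q R K' constEmb … hinvc hinvp`,
`T := C.thetaEnvData μ hC hS`, `ι := id`, `DK :=` abc-iut-L2-t4's `dkOfConnectedTemperoidData … hconst hK` (`= α.kummerOut hK`, rfl):
* **`envIsoBiTheta_ofThetaSettingData_of_constantsDictionary`** — [EtTh] Lemma 5.9 (iv) IN FULL (abc-iut-L2-t4's `EnvIsoBiTheta`: "the natural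
  inclusions … determine an isomorphism of topological groups `E^Π_N ⥲ Π^tp_Y[μ_N]` which is an isomorphism of mod `N` bi-theta environments"),
  not only its "In particular";
* **`frdIsMonoThetaEnv_ofThetaSettingData_of_originClause`** / `envIsoBiTheta_ofThetaSettingData_of_originClause` — the same with the pair
  (`η ∈ thetaCocycles`, `hcompat`) replaced by abc-iut-f-125's Prop. 5.2 (iii) ORIGIN CLAUSE «the transported bi-Kummer difference cocycle
  `k ↦ m(d(k))⁻¹` of the §5 data of the Setting lies in `C.thetaCocycles hC μ`» (GAP G-L2t4-2, pin `θ := Θ̈`) — so the [IUTchII] Prop. 1.2 (ii)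
  binder `hM` at the setting's §5 data is certified MODULO EXACTLY {`hD`, `hconst`, `H : Facts` (⟸ hconst + hD, p440765), that origin clause};
* **`monoThetaEnvCompat_ofThetaSettingData_of_constantsDictionary`** — [EtTh] Theorem 5.10 (iii) (abc-iut-L2-t4's `MonoThetaEnvCompat`) for
  the §5 data of the Setting at the honest `DK`, modulo {`hD`, `hconst`, `H`, Thm. 5.10 (ii) as typed + the representative `ψY`, the clause `hΔ`
  (⟸ Cor. 2.18 (i))} — the openness of `Π^tp_X ↠ G_K` being DISCHARGED from temperedness (abc-iut-L3's `isOpenMap_augGK_of_isTempered`) as in p440765.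
HONEST FRAMING: kernel-checked compositions over the typed junction; `tf` is an abstract parameter (not inhabited for the curve); nothing of [EtTh]
is asserted unconditionally; typed ≠ proved; no side is taken on anything downstream ([IUTchIII] Cor. 3.12).
-/

noncomputable section

namespace Literature.AnabelianGeometry.EtaleTheta

open CategoryTheory Opposite Literature.AlgebraicGeometry.Frobenioids Literature.AnabelianGeometry.SemiGraphs
  Literature.AnabelianGeometry.SemiGraphs.GaloisObjects Literature.AlgebraicGeometry.Frobenioids.QuasiTemperoid.BTempConnected
open scoped Pointwise

universe v₀

namespace ThetaFrobenioid

section Junction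

variable {p : ℕ} [Fact p.Prime] {D : ThetaSetting p} {E : D.EtaleThetaData} {l : ℕ} {C : E.DoubleUnderline l}
  {e : D.toTemperedCurve.GroupLevelData} {N : ℕ+} (μ : D.CyclotomeMod l N) (hC : D.Compat) (hS : D.Sec2Hyps)
  {D₀ : Type} [Category.{v₀} D₀] {V : FrdIMonoidStub.{0}} {T₀ : RealifiedDivisorMonoids (D₀ := D₀) V}
  {VD : FrdICatStub.{1, 0, 0} (ConnectedPart (BTemp (C.temperedArithmeticGroup e).Pi))}
  {tf : TemperedFrobenioid T₀ (ConnectedPart (BTemp (C.temperedArithmeticGroup e).Pi)) VD} {hZ : tf.monoidType = MonoidType.Z}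
  {hP : ∀ A : (ConnectedPart (BTemp (C.temperedArithmeticGroup e).Pi))ᵒᵖ, IsPerfect (tf.Φ.carrier A)}
  {NH : Subgroup (Field.absoluteGaloisGroup D.K) → tf.category → ℕ+ → Prop} {A₀ : tf.category}
  {hA₀ : PreFrobenioid.IsFrobeniusTrivial tf.toElem A₀} {hA₀' : SemiGraphs.IsGaloisObj A₀.base.obj}
  {pullFrac : ∀ {A A' : (BiKummerSetting.mkOfConnectedTemperoid (C.temperedArithmeticGroup e) tf hZ hP NH A₀ hA₀ hA₀').C} (_ : A' ⟶ A),
    (BiKummerSetting.mkOfConnectedTemperoid (C.temperedArithmeticGroup e) tf hZ hP NH A₀ hA₀ hA₀').biratUnits A →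
      (BiKummerSetting.mkOfConnectedTemperoid (C.temperedArithmeticGroup e) tf hZ hP NH A₀ hA₀ hA₀').biratUnits A'}
  {θ : (BiKummerSetting.mkOfConnectedTemperoid (C.temperedArithmeticGroup e) tf hZ hP NH A₀ hA₀ hA₀').biratUnits
    (BiKummerSetting.mkOfConnectedTemperoid (C.temperedArithmeticGroup e) tf hZ hP NH A₀ hA₀ hA₀').Aodot}
  {Bl : (BiKummerSetting.mkOfConnectedTemperoid (C.temperedArithmeticGroup e) tf hZ hP NH A₀ hA₀ hA₀').C}
  {Pl : (BiKummerSetting.mkOfConnectedTemperoid (C.temperedArithmeticGroup e) tf hZ hP NH A₀ hA₀ hA₀').FractionPair θ Bl}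
  {Rl : (BiKummerSetting.mkOfConnectedTemperoid (C.temperedArithmeticGroup e) tf hZ hP NH A₀ hA₀ hA₀').NthRoot θ Pl C.lPNat pullFrac}
  (h : ModelFrobenioid.Hypotheses tf.divisorMonoid tf.ratFnFunctor)
  (Q : FrobenioidTheta.ThetaSubquotientStub.{0} (ConnectedPart (BTemp (C.temperedArithmeticGroup e).Pi)))
  (R : (BiKummerSetting.mkOfConnectedTemperoid (C.temperedArithmeticGroup e) tf hZ hP NH A₀ hA₀ hA₀').NthRoot Rl.root Rl.pair N pullFrac)
  (K' : Type) [Field K'] (constEmb : K'ˣ →* tf.biratUnitsModel R.BN) (constEmb_injective : Function.Injective constEmb)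
  (hinvc : ∀ g : Aut R.AN.base,
    pull tf.divisorMonoid g.hom (ModelFrobenioid.div R.pair.num) = ModelFrobenioid.div R.pair.num)
  (hinvp : ∀ y : (C.thetaEnvData μ hC hS).PiX, y ∈ (C.thetaEnvData μ hC hS).PiYdd →
    pull tf.divisorMonoid ((BiKummerSetting.mkOfConnectedTemperoid (C.temperedArithmeticGroup e) tf hZ hP NH A₀ hA₀ hA₀').galoisSurj
      R.AN.base R.αData.isGalois ((ContinuousMulEquiv.refl _) y)).hom (ModelFrobenioid.div R.pair.den) = ModelFrobenioid.div R.pair.den)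
  (hconst : ∀ (ε : Aut R.BN) (k : K'ˣ), tf.biratAutModel R.BN ε (constEmb k) = constEmb k)
  (m : (ofThetaSettingData μ hC hS h Q R K' constEmb constEmb_injective hinvc hinvp).muTorsion
      (ofThetaSettingData μ hC hS h Q R K' constEmb constEmb_injective hinvc hinvp).BN N ≃* (C.thetaEnvData μ hC hS).mu)
  {Cst : Subgroup ((ofThetaSettingData μ hC hS h Q R K' constEmb constEmb_injective hinvc hinvp).biratUnits
      (ofThetaSettingData μ hC hS h Q R K' constEmb constEmb_injective hinvc hinvp).BN)}
  {ν' : Cst →* (PadicAlgCl p)ˣ}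
  (hD : BiratAutAction.ConstantsDictionary
    (biratAutAction_ofConnectedTemperoidData (T := C.thetaEnvData μ hC hS) h Q C.odd_lPNat R (ContinuousMulEquiv.refl _) K' constEmb
      constEmb_injective hinvc hinvp hconst) C μ hC hS (ContinuousMulEquiv.refl _) m Cst ν')

include hD

/-- **[EtTh] Lemma 5.9 (iv) IN FULL for the §5 data OF THE SETTING at the honest `DK`** (abc-iut-L2-t4's `EnvIsoBiTheta`: "the natural inclusions
`μ_N(B_N) ↪ E_N`, `Im(Π^tp_Y) ⊆ E_N` determine an isomorphism of topological groups `E^Π_N ⥲ Π^tp_Y[μ_N]` which is an isomorphism of mod `N` bi-theta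
environments"), FROM THE ONE DICTIONARY BINDER: this seat's `ConstantsDictionary.envIsoBiTheta_kummerOut` with `hY`, `hYdd`, `hopenX`, `hK` supplied by
abc-iut-L2-t4's junction lemmas (p440765).  Residual: `H : Facts` (⟸ `hconst` + `hD`), `η ∈ thetaCocycles` + `hcompat` (F-0521).
[cite: MochizukiEtTh2009, Lem 5.9 (iv) p.332 (PDF p.106)] -/
theorem envIsoBiTheta_ofThetaSettingData_of_constantsDictionary
    (h1 : (ofThetaSettingData μ hC hS h Q R K' constEmb constEmb_injective hinvc hinvp).SectionsFactor)
    (h3 : (ofThetaSettingData μ hC hS h Q R K' constEmb constEmb_injective hinvc hinvp).OuterActionLZ)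
    (hsec : (ofThetaSettingData μ hC hS h Q R K' constEmb constEmb_injective hinvc hinvp).SgpCapSection)
    (hcs : (ofThetaSettingData μ hC hS h Q R K' constEmb constEmb_injective hinvc hinvp).SgpCupSection)
    (h8 : (ofThetaSettingData μ hC hS h Q R K' constEmb constEmb_injective hinvc hinvp).ConstantsEqNormalizer)
    (H : (ofThetaSettingData μ hC hS h Q R K' constEmb constEmb_injective hinvc hinvp).Facts)
    {η : (C.thetaEnvData μ hC hS).PiYdd → (C.thetaEnvData μ hC hS).mu} (hη : η ∈ (C.thetaEnvData μ hC hS).thetaCocycles)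
    (hcompat : (ofThetaSettingData μ hC hS h Q R K' constEmb constEmb_injective hinvc hinvp).ThetaSectionCompat H (C.thetaEnvData μ hC hS)
      (ContinuousMulEquiv.refl _).toMulEquiv m
      (identifiesPiYdd_ofThetaSettingData' μ hC hS h Q R K' constEmb constEmb_injective hinvc hinvp) η) :
    (ofThetaSettingData μ hC hS h Q R K' constEmb constEmb_injective hinvc hinvp).EnvIsoBiTheta h1 h3 hsec hcs h8
      (dkOfConnectedTemperoidData (T := C.thetaEnvData μ hC hS) h Q C.odd_lPNat R (ContinuousMulEquiv.refl _) K' constEmb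
        constEmb_injective hinvc hinvp hconst
        (kxRootNModCyclotome_ofThetaSettingData_of_constantsDictionary μ hC hS h Q R K' constEmb constEmb_injective hinvc hinvp hconst m hD))
      (C.thetaEnvData μ hC hS) (ContinuousMulEquiv.refl _) :=
  hD.envIsoBiTheta_kummerOut
    (kxRootNModCyclotome_ofThetaSettingData_of_constantsDictionary μ hC hS h Q R K' constEmb constEmb_injective hinvc hinvp hconst m hD)
    h1 h3 hsec hcs h8 H (identifiesPiY_ofThetaSettingData μ hC hS h Q R K' constEmb constEmb_injective hinvc hinvp)
    (identifiesPiYdd_ofThetaSettingData' μ hC hS h Q R K' constEmb constEmb_injective hinvc hinvp)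
    (by haveI := e.secondCountableTopology; exact D.toTemperedCurve.isOpenMap_augGK_of_isTempered e.isTempered) hη hcompat

/-- **Lemma 5.9 (iv) in full at the setting's §5 data MODULO THE PROP. 5.2 (iii) ORIGIN CLAUSE**: as above with `η :=` the transported bi-Kummer
difference cocycle `k ↦ m(d(k))⁻¹` (the unique solution of the dictionary, abc-iut-f-116 / abc-iut-f-125's `thetaSectionCompat_ofThetaSettingData_transport`)
and the ONE origin clause «that cocycle lies in `C.thetaCocycles hC μ`» ("the Kummer class determined by the bi-Kummer `N`-th root … corresponds
precisely to the reduction modulo `N` of the class `η̲̈^Θ`", Prop. 5.2 (iii) p.324; GAP G-L2t4-2, pin `θ := Θ̈`).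
[cite: MochizukiEtTh2009, Lem 5.9 (iv) p.332 (PDF p.106); Prop 5.2 (iii) p.324 (PDF p.98)] -/
theorem envIsoBiTheta_ofThetaSettingData_of_originClause
    (H : (ofThetaSettingData μ hC hS h Q R K' constEmb constEmb_injective hinvc hinvp).Facts)
    (hΘ : (fun k : (C.thetaEnvData μ hC hS).PiYdd =>
        (m ((ofThetaSettingData μ hC hS h Q R K' constEmb constEmb_injective hinvc hinvp).diffCocycle H k))⁻¹) ∈
      C.thetaCocycles hC μ) :
    (ofThetaSettingData μ hC hS h Q R K' constEmb constEmb_injective hinvc hinvp).EnvIsoBiTheta H.sectionsFactor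
      (ofThetaSettingData μ hC hS h Q R K' constEmb constEmb_injective hinvc hinvp).outerActionLZ_of H.sgpCapSection H.sgpCupSection
      H.constantsEqNormalizer
      (dkOfConnectedTemperoidData (T := C.thetaEnvData μ hC hS) h Q C.odd_lPNat R (ContinuousMulEquiv.refl _) K' constEmb
        constEmb_injective hinvc hinvp hconst
        (kxRootNModCyclotome_ofThetaSettingData_of_constantsDictionary μ hC hS h Q R K' constEmb constEmb_injective hinvc hinvp hconst m hD))
      (C.thetaEnvData μ hC hS) (ContinuousMulEquiv.refl _) :=
  envIsoBiTheta_ofThetaSettingData_of_constantsDictionary μ hC hS h Q R K' constEmb constEmb_injective hinvc hinvp hconst m hD H.sectionsFactor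
    (ofThetaSettingData μ hC hS h Q R K' constEmb constEmb_injective hinvc hinvp).outerActionLZ_of H.sgpCapSection
    H.sgpCupSection H.constantsEqNormalizer H hΘ
    (thetaSectionCompat_ofThetaSettingData_transport μ hC hS h Q R K' constEmb constEmb_injective hinvc hinvp H m)

/-- **The [IUTchII] Prop. 1.2 (ii) binder `hM` for the §5 data OF THE SETTING MODULO THE PROP. 5.2 (iii) ORIGIN CLAUSE** — Lemma 5.9 (iv) "In
particular, omitting the homomorphism `s^⊓-Π_N` yields a mod `N` mono-theta environment" (abc-iut-L2-t4's `FrdIsMonoThetaEnv` at the honest `DK`):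
abc-iut-L2-t4's `frdIsMonoThetaEnv_ofThetaSettingData_of_constantsDictionary` (p440765) with (`η ∈ thetaCocycles`, `hcompat`) replaced by the one origin
clause.  RESIDUAL EXACTLY: the data, `hconst`, the ONE dictionary binder `hD`, `H : Facts` (⟸ `hconst` + `hD`), the origin clause `hΘ`.
[cite: MochizukiEtTh2009, Lem 5.9 (iv) p.332 (PDF p.106); Prop 5.2 (iii) p.324 (PDF p.98)] -/
theorem frdIsMonoThetaEnv_ofThetaSettingData_of_originClause
    (H : (ofThetaSettingData μ hC hS h Q R K' constEmb constEmb_injective hinvc hinvp).Facts)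
    (hΘ : (fun k : (C.thetaEnvData μ hC hS).PiYdd =>
        (m ((ofThetaSettingData μ hC hS h Q R K' constEmb constEmb_injective hinvc hinvp).diffCocycle H k))⁻¹) ∈
      C.thetaCocycles hC μ) :
    (ofThetaSettingData μ hC hS h Q R K' constEmb constEmb_injective hinvc hinvp).FrdIsMonoThetaEnv H.sectionsFactor
      (ofThetaSettingData μ hC hS h Q R K' constEmb constEmb_injective hinvc hinvp).outerActionLZ_of H.sgpCapSection H.sgpCupSection
      H.constantsEqNormalizer
      (dkOfConnectedTemperoidData (T := C.thetaEnvData μ hC hS) h Q C.odd_lPNat R (ContinuousMulEquiv.refl _) K' constEmb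
        constEmb_injective hinvc hinvp hconst
        (kxRootNModCyclotome_ofThetaSettingData_of_constantsDictionary μ hC hS h Q R K' constEmb constEmb_injective hinvc hinvp hconst m hD))
      (C.thetaEnvData μ hC hS) :=
  frdIsMonoThetaEnv_ofThetaSettingData_of_constantsDictionary μ hC hS h Q R K' constEmb constEmb_injective hinvc hinvp hconst m hD H.sectionsFactor
    (ofThetaSettingData μ hC hS h Q R K' constEmb constEmb_injective hinvc hinvp).outerActionLZ_of H.sgpCapSection
    H.sgpCupSection H.constantsEqNormalizer H hΘ
    (thetaSectionCompat_ofThetaSettingData_transport μ hC hS h Q R K' constEmb constEmb_injective hinvc hinvp H m)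

/-- **[EtTh] Theorem 5.10 (iii) (abc-iut-L2-t4's `MonoThetaEnvCompat`) for the §5 data OF THE SETTING at the honest `DK`, FROM THE ONE DICTIONARY
BINDER** (this seat's `ConstantsDictionary.monoThetaEnvCompat_kummerOut` at the junction; the openness of `Π^tp_X ↠ G_K` DISCHARGED from temperedness
as in p440765).  Residual: `H : Facts`, Thm. 5.10 (ii) as typed with the representative `ψY`, and the clause `hΔ` ("every topological automorphism of
`Π^tp_X̲̲` preserves `Π^tp_Y̲̲ ∩ Ker(↠ G_K)`", ⟸ Cor. 2.18 (i)).  [cite: MochizukiEtTh2009, Thm 5.10 (iii) p.334–335 (PDF pp.108–109)] -/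
theorem monoThetaEnvCompat_ofThetaSettingData_of_constantsDictionary
    (h1 : (ofThetaSettingData μ hC hS h Q R K' constEmb constEmb_injective hinvc hinvp).SectionsFactor)
    (h3 : (ofThetaSettingData μ hC hS h Q R K' constEmb constEmb_injective hinvc hinvp).OuterActionLZ)
    (hsec : (ofThetaSettingData μ hC hS h Q R K' constEmb constEmb_injective hinvc hinvp).SgpCapSection)
    (hcs : (ofThetaSettingData μ hC hS h Q R K' constEmb constEmb_injective hinvc hinvp).SgpCupSection)
    (h8 : (ofThetaSettingData μ hC hS h Q R K' constEmb constEmb_injective hinvc hinvp).ConstantsEqNormalizer)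
    (H : (ofThetaSettingData μ hC hS h Q R K' constEmb constEmb_injective hinvc hinvp).Facts)
    (hΔ : ∀ (ψ : (ofThetaSettingData μ hC hS h Q R K' constEmb constEmb_injective hinvc hinvp).PiX ≃ₜ*
        (ofThetaSettingData μ hC hS h Q R K' constEmb constEmb_injective hinvc hinvp).PiX),
      ∀ y ∈ (ofThetaSettingData μ hC hS h Q R K' constEmb constEmb_injective hinvc hinvp).PiY,
        (C.thetaEnvData μ hC hS).aug ((ContinuousMulEquiv.refl _) (ψ y)) = 1 ↔
          (C.thetaEnvData μ hC hS).aug ((ContinuousMulEquiv.refl (C.thetaEnvData μ hC hS).PiX) y) = 1)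
    (Ψ : (BiKummerSetting.mkOfConnectedTemperoid (C.temperedArithmeticGroup e) tf hZ hP NH A₀ hA₀ hA₀').C ≌
      (BiKummerSetting.mkOfConnectedTemperoid (C.temperedArithmeticGroup e) tf hZ hP NH A₀ hA₀ hA₀').C)
    (β : Ψ.functor.obj (ofThetaSettingData μ hC hS h Q R K' constEmb constEmb_injective hinvc hinvp).BN ≅
      (ofThetaSettingData μ hC hS h Q R K' constEmb constEmb_injective hinvc hinvp).BN)
    (ΨbiratAut : (ofThetaSettingData μ hC hS h Q R K' constEmb constEmb_injective hinvc hinvp).biratUnits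
        (ofThetaSettingData μ hC hS h Q R K' constEmb constEmb_injective hinvc hinvp).BN ≃*
      (ofThetaSettingData μ hC hS h Q R K' constEmb constEmb_injective hinvc hinvp).biratUnits
        (ofThetaSettingData μ hC hS h Q R K' constEmb constEmb_injective hinvc hinvp).BN)
    (hii : (ofThetaSettingData μ hC hS h Q R K' constEmb constEmb_injective hinvc hinvp).PsiAutPreserves Ψ β ΨbiratAut)
    (ψY : (ofThetaSettingData μ hC hS h Q R K' constEmb constEmb_injective hinvc hinvp).PiX ≃ₜ*
      (ofThetaSettingData μ hC hS h Q R K' constEmb constEmb_injective hinvc hinvp).PiX)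
    (hbase : ∀ g, (ofThetaSettingData μ hC hS h Q R K' constEmb constEmb_injective hinvc hinvp).autBase
        (ofThetaSettingData μ hC hS h Q R K' constEmb constEmb_injective hinvc hinvp).BN
        ((ofThetaSettingData μ hC hS h Q R K' constEmb constEmb_injective hinvc hinvp).psiAut Ψ β
          ((ofThetaSettingData μ hC hS h Q R K' constEmb constEmb_injective hinvc hinvp).sgpCap
            ((ofThetaSettingData μ hC hS h Q R K' constEmb constEmb_injective hinvc hinvp).ρ g))) =
      (ofThetaSettingData μ hC hS h Q R K' constEmb constEmb_injective hinvc hinvp).ρ (ψY g))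
    (hψY : (ofThetaSettingData μ hC hS h Q R K' constEmb constEmb_injective hinvc hinvp).PiY.map ψY.toMulEquiv.toMonoidHom =
      (ofThetaSettingData μ hC hS h Q R K' constEmb constEmb_injective hinvc hinvp).PiY)
    (hψYdd : (ofThetaSettingData μ hC hS h Q R K' constEmb constEmb_injective hinvc hinvp).PiYdd.map ψY.toMulEquiv.toMonoidHom =
      (ofThetaSettingData μ hC hS h Q R K' constEmb constEmb_injective hinvc hinvp).PiYdd) :
    (ofThetaSettingData μ hC hS h Q R K' constEmb constEmb_injective hinvc hinvp).MonoThetaEnvCompat h1 h3 hsec hcs h8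
      (dkOfConnectedTemperoidData (T := C.thetaEnvData μ hC hS) h Q C.odd_lPNat R (ContinuousMulEquiv.refl _) K' constEmb
        constEmb_injective hinvc hinvp hconst
        (kxRootNModCyclotome_ofThetaSettingData_of_constantsDictionary μ hC hS h Q R K' constEmb constEmb_injective hinvc hinvp hconst m hD))
      Ψ β ψY hbase hψY hψYdd :=
  hD.monoThetaEnvCompat_kummerOut
    (kxRootNModCyclotome_ofThetaSettingData_of_constantsDictionary μ hC hS h Q R K' constEmb constEmb_injective hinvc hinvp hconst m hD)
    h1 h3 hsec hcs h8 H (identifiesPiY_ofThetaSettingData μ hC hS h Q R K' constEmb constEmb_injective hinvc hinvp)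
    (by haveI := e.secondCountableTopology; exact D.toTemperedCurve.isOpenMap_augGK_of_isTempered e.isTempered) hΔ Ψ β ΨbiratAut hii ψY hbase hψY hψYdd

end Junction

end ThetaFrobenioid

end Literature.AnabelianGeometry.EtaleTheta

end
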